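import Literature.NumberTheory.DiophantineGeometry.GenEllMell
import Literature.NumberTheory.DiophantineGeometry.LocalReduction
import Literature.NumberTheory.EllipticCurves.GaloisAction
import Mathlib.LinearAlgebra.Matrix.SpecialLinearGroup
import Mathlib.LinearAlgebra.Matrix.GeneralLinearGroup.Defs
import Mathlib.NumberTheory.Padics.RingHoms
import Mathlib.NumberTheory.NumberField.InfinitePlace.TotallyRealComplex
import Mathlib.Analysis.SpecialFunctions.Pow.Real
import HarnessLib

/-!
# [GenEll] §3: Lemma 3.1 (structure of `SL₂`), `l`-cyclic subgroup schemes, Lemma 3.5, Lemma 3.6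

S. Mochizuki, *Arithmetic elliptic curves in general position*, Math. J. Okayama Univ. 52 (2010)
[cite: MochizukiGenEll2010] (kurims manuscript, Feb. 2009), read on the page:

> (pp. 13–14) **Lemma 3.1. (The Structure of SL₂)** Let `l ≥ 5` be a prime number. Then:
> (i) Let `G ⊆ SL₂(𝔽_l)` be the subgroup generated by the matrices `α := (1 1; 0 1)`, `β := (1 0; 1 1)`.
> Then `G = SL₂(𝔽_l)`. (ii) The finite group `SL₂(𝔽_l)` has no nontrivial abelian quotients.
> (iii) Let `H ⊆ GL₂(𝔽_l)` be a subgroup that contains the matrix `α`, as well as at least one matrix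
> that is not upper triangular. Then `SL₂(𝔽_l) ⊆ H`. (iv) Let `J ⊆ GL₂(ℤ_l)` be a closed subgroup whose
> image `H_J` in `GL₂(𝔽_l)` contains the matrix `α`, as well as a matrix which is not upper triangular.
> Then `SL₂(ℤ_l) ⊆ J`.
> (p. 17) **Lemma 3.5. (Global Rank One Subgroups of `l`-Torsion)** Let `ε ∈ ℝ_{>0}`; `l` a prime
> number; `H_F ⊆ E_F` a subgroup scheme such that `H_F ×_F Q̄` is isomorphic to the constant group
> scheme determined by `ℤ/l·ℤ`. We shall call such a subgroup scheme `l`-cyclic. […] Suppose further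
> that `l` is prime to the local heights of `E` at all of its primes of [bad] multiplicative reduction
> […]. Then we have `(1/(12(1+ε)))·l·deg_∞(E) ≤ ht^Falt(E) + 2 log(l) + C` for some constant `C ∈ ℝ`
> which [may depend on `ε` but] is independent of `E`, `F`, `H_F`, and `l`.
> (pp. 17–18) **Lemma 3.6. (An Elementary Estimate)** Let `ε ∈ ℝ_{>0}`. Then there exists a constant
> `C₀ ∈ ℝ_{>0}` such that for all `x, y ∈ ℝ` such that `y ≥ 1` and `x ≥ C₀ y^{1+ε}`, it holds that
> `x ≥ y · log(x)`.

Standing hypotheses of [GenEll] §3 for Lemma 3.5 (p. 16): "`F ⊆ Q̄` a number field, `E → Spec(𝓞_F)` a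
one-dimensional semi-abelian variety whose generic fiber `E_F` is proper" (i.e. `E_F` has semistable
reduction everywhere — the tree's `WeierstrassCurve.IsSemistable (𝓞 F)`), "for simplicity, we assume
that `F` is totally imaginary" (Mathlib `NumberField.IsTotallyComplex`).

## What is here

* Lemma 3.1 (i), (ii) PROVED (`GenEll_lemma31_i`, `GenEll_lemma31_ii`: Mathlib's
  `Matrix.SL2.transvection_induction` / `Matrix.SL2.commutator_eq_top`) and (iii), (iv) as named
  statements of group theory (`GenEll_lemma31_iii`, `GenEll_lemma31_iv`; (iv) = [Serre] IV §3.4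
  Lemma 3, as cited) over Mathlib's `Matrix.SpecialLinearGroup (Fin 2) (ZMod l)`, `GL (Fin 2) (ZMod l)`,
  `GL (Fin 2) ℤ_[l]`;
* `EllPoint.AdmitsLCyclic P l` — "`E_F` admits an `l`-cyclic subgroup scheme": a `Γ_F`-stable subgroup
  of order `l` of `E[l](Q̄)` (the tree's `WeierstrassCurve.geomTorsion` with its Galois action);
* `GenEll_lemma35` — Lemma 3.5 as a named fact over `GenEllMell.lean` (`degInf`, `htFalt`,
  `localHeight`) and the tree's reduction types (`LocalReduction.lean`);
* `GenEll_lemma36` — Lemma 3.6, PROVED (`log x ≤ x^t/t`).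
-/

noncomputable section

open NumberField IsDedekindDomain Matrix

namespace Literature.NumberTheory.DiophantineGeometry.GenEll

/-! ## Lemma 3.1 — the structure of `SL₂` -/

section SL2

/-- The matrix `α = (1 1; 0 1) ∈ SL₂(R)`. [cite: MochizukiGenEll2010, Lem 3.1 p.14] -/
def sl2Alpha (R : Type*) [CommRing R] : SpecialLinearGroup (Fin 2) R :=
  ⟨!![1, 1; 0, 1], by simp [Matrix.det_fin_two_of]⟩

/-- The matrix `β = (1 0; 1 1) ∈ SL₂(R)`. [cite: MochizukiGenEll2010, Lem 3.1 p.14] -/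
def sl2Beta (R : Type*) [CommRing R] : SpecialLinearGroup (Fin 2) R :=
  ⟨!![1, 0; 1, 1], by simp [Matrix.det_fin_two_of]⟩

/-- A `2 × 2` matrix is upper triangular iff its `(2,1)` entry vanishes.
[cite: MochizukiGenEll2010, Lem 3.1 (iii) p.14] -/
def IsUpperTriangular {R : Type*} [Zero R] (M : Matrix (Fin 2) (Fin 2) R) : Prop := M 1 0 = 0

/-- In `SL₂(ZMod l)`, a transvection with natural-number coefficient is a power of the unit
transvection. [folklore] -/
private theorem transvection_natCast {l : ℕ} [Fact l.Prime] {i j : Fin 2} (hij : i ≠ j) (n : ℕ) :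
    SpecialLinearGroup.transvection hij (n : ZMod l) = (SpecialLinearGroup.transvection hij 1) ^ n := by
  induction n with
  | zero => simp
  | succ n ih => rw [Nat.cast_succ, SpecialLinearGroup.transvection_add, ih, pow_succ]

/-- **[GenEll] Lemma 3.1 (i)**, PROVED: for a prime `l ≥ 5` (indeed for every prime `l`), `SL₂(𝔽_l)` is
generated by `α = (1 1; 0 1)` and `β = (1 0; 1 1)` (Mathlib: `SL₂` over a field is generated by
transvections, `Matrix.SL2.transvection_induction`; in `𝔽_l` every transvection is a power of `α` or
`β`). [cite: MochizukiGenEll2010, Lem 3.1 (i) p.14] -/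
theorem GenEll_lemma31_i (l : ℕ) [Fact l.Prime] :
    Subgroup.closure ({sl2Alpha (ZMod l), sl2Beta (ZMod l)} : Set (SpecialLinearGroup (Fin 2) (ZMod l)))
      = ⊤ := by
  set G := Subgroup.closure
    ({sl2Alpha (ZMod l), sl2Beta (ZMod l)} : Set (SpecialLinearGroup (Fin 2) (ZMod l))) with hG
  refine (Subgroup.eq_top_iff' G).mpr fun A => ?_
  refine Matrix.SL2.transvection_induction (fun A => A ∈ G) ?_ (fun A B hA hB => G.mul_mem hA hB) A
  intro i j hij c
  rw [← ZMod.natCast_zmod_val c, transvection_natCast hij]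
  refine G.pow_mem ?_ _
  have hα : ∀ (h01 : (0 : Fin 2) ≠ 1), SpecialLinearGroup.transvection h01 (1 : ZMod l) = sl2Alpha (ZMod l) := by
    intro h01
    apply Subtype.ext
    rw [SpecialLinearGroup.transvection_coe]
    ext a b; fin_cases a <;> fin_cases b <;> simp [sl2Alpha, Matrix.single]
  have hβ : ∀ (h10 : (1 : Fin 2) ≠ 0), SpecialLinearGroup.transvection h10 (1 : ZMod l) = sl2Beta (ZMod l) := by
    intro h10
    apply Subtype.ext
    rw [SpecialLinearGroup.transvection_coe]
    ext a b; fin_cases a <;> fin_cases b <;> simp [sl2Beta, Matrix.single]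
  have hi : i = 0 ∨ i = 1 := by omega
  have hj : j = 0 ∨ j = 1 := by omega
  rcases hi with rfl | rfl <;> rcases hj with rfl | rfl
  · exact absurd rfl hij
  · rw [hα hij]; exact Subgroup.subset_closure (Set.mem_insert _ _)
  · rw [hβ hij]; exact Subgroup.subset_closure (Set.mem_insert_of_mem _ (Set.mem_singleton _))
  · exact absurd rfl hij

/-- **[GenEll] Lemma 3.1 (ii)**, PROVED: for a prime `l ≥ 5`, `SL₂(𝔽_l)` has no nontrivial abelian
quotients, i.e. it is perfect (Mathlib `Matrix.SL2.commutator_eq_top` with `a = 2`: `2 ≠ 0` and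
`2² ≠ 1` in `𝔽_l` as `l ∤ 2, 3`; the paper's `ε α ε⁻¹ α⁻¹ = α^{λ²−1}` argument).
[cite: MochizukiGenEll2010, Lem 3.1 (ii) p.14] -/
theorem GenEll_lemma31_ii (l : ℕ) [Fact l.Prime] (hl : 5 ≤ l) :
    commutator (SpecialLinearGroup (Fin 2) (ZMod l)) = ⊤ := by
  have h2 : (2 : ZMod l) ≠ 0 := by
    intro h
    have h' : ((2 : ℕ) : ZMod l) = 0 := by exact_mod_cast h
    rw [ZMod.natCast_eq_zero_iff] at h'
    have := Nat.le_of_dvd two_pos h'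
    omega
  have h4 : (2 : ZMod l) ^ 2 ≠ 1 := by
    intro h
    have h' : ((4 : ℕ) : ZMod l) = ((1 : ℕ) : ZMod l) := by norm_num; exact_mod_cast h
    rw [ZMod.natCast_eq_natCast_iff'] at h'
    have h3 : 4 % l = 4 := Nat.mod_eq_of_lt (by omega)
    have h1 : 1 % l = 1 := Nat.mod_eq_of_lt (by omega)
    omega
  exact Matrix.SL2.commutator_eq_top h2 h4

/-- **[GenEll] Lemma 3.1 (iii).** For a prime `l ≥ 5` and a subgroup `H ⊆ GL₂(𝔽_l)` containing
`α = (1 1; 0 1)` and at least one matrix that is not upper triangular, `SL₂(𝔽_l) ⊆ H`.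
[cite: MochizukiGenEll2010, Lem 3.1 (iii) p.14] -/
def GenEll_lemma31_iii : Prop :=
  ∀ (l : ℕ) [Fact l.Prime], 5 ≤ l → ∀ H : Subgroup (GL (Fin 2) (ZMod l)),
    (SpecialLinearGroup.toGL (sl2Alpha (ZMod l))) ∈ H →
    (∃ M ∈ H, ¬ IsUpperTriangular (M : Matrix (Fin 2) (Fin 2) (ZMod l))) →
      ∀ S : SpecialLinearGroup (Fin 2) (ZMod l), SpecialLinearGroup.toGL S ∈ H

/-- **[GenEll] Lemma 3.1 (iv)** ([Serre], IV §3.4 Lemma 3, as cited there). For a prime `l ≥ 5` and a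
closed subgroup `J ⊆ GL₂(ℤ_l)` whose image in `GL₂(𝔽_l)` contains `α` and a matrix that is not upper
triangular, `SL₂(ℤ_l) ⊆ J`. [cite: MochizukiGenEll2010, Lem 3.1 (iv) p.14] -/
def GenEll_lemma31_iv : Prop :=
  ∀ (l : ℕ) [Fact l.Prime], 5 ≤ l → ∀ J : Subgroup (GL (Fin 2) ℤ_[l]),
    IsClosed (J : Set (GL (Fin 2) ℤ_[l])) →
    (SpecialLinearGroup.toGL (sl2Alpha (ZMod l))) ∈ J.map (GeneralLinearGroup.map (PadicInt.toZMod (p := l))) →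
    (∃ M ∈ J.map (GeneralLinearGroup.map (PadicInt.toZMod (p := l))),
      ¬ IsUpperTriangular (M : Matrix (Fin 2) (Fin 2) (ZMod l))) →
      ∀ S : SpecialLinearGroup (Fin 2) ℤ_[l], SpecialLinearGroup.toGL S ∈ J

end SL2

/-! ## `l`-cyclic subgroup schemes; Lemma 3.5 -/

namespace EllPoint

/-- `E_F` has semistable (good or multiplicative) reduction at every finite prime of `F` — the
standing hypothesis of [GenEll] §3 ("`E → Spec(𝓞_F)` a one-dimensional semi-abelian variety whose
generic fiber `E_F` is proper", p. 16); the tree's `WeierstrassCurve.IsSemistable`.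
[cite: MochizukiGenEll2010, §3 p.16] -/
def IsSemistable (P : EllPoint) : Prop := P.W.IsSemistable (𝓞 P.F)

/-- **"`E_F` admits an `l`-cyclic subgroup scheme"** ([GenEll] Lemma 3.5: a subgroup scheme
`H_F ⊆ E_F` with `H_F ×_F Q̄ ≅ ℤ/l·ℤ`): a subgroup of order `l` of the geometric `l`-torsion
`E[l] = E(F̄)[l]` stable under `Γ_F = Gal(F̄/F)` (the tree's `WeierstrassCurve.geomTorsion` with its
Galois action). [cite: MochizukiGenEll2010, Lem 3.5 p.17] -/
def AdmitsLCyclic (P : EllPoint) (l : ℕ) : Prop :=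
  ∃ H : AddSubgroup (P.W.geomTorsion (l : ℤ)),
    (∀ σ : Field.absoluteGaloisGroup P.F, ∀ x ∈ H, σ • x ∈ H) ∧ Nat.card H = l

end EllPoint

/-- NAMED FACT — **[GenEll] Lemma 3.5 (Global Rank One Subgroups of `l`-Torsion)**, under the standing
hypotheses of §3 (`F` totally imaginary, `E_F` with semistable reduction everywhere): for every
`ε > 0` there is `C ∈ ℝ` such that for every such presented `E_F`, every prime `l` prime to the local
heights of `E` at all of its primes of multiplicative reduction, if `E_F` admits an `l`-cyclic
subgroup scheme then `(1/(12(1+ε)))·l·deg_∞(E) ≤ ht^Falt(E) + 2 log(l) + C`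
(`C` independent of `E`, `F`, `H_F`, `l`). Printed proof: Lemma 3.2 + Prop. 3.4 ([Silv2] Prop. 2.1)
+ [FC] I.2.7. [cite: MochizukiGenEll2010, Lem 3.5 p.17] -/
def GenEll_lemma35 : Prop :=
  ∀ ε : ℝ, 0 < ε → ∃ C : ℝ, ∀ (P : EllPoint) (l : ℕ), l.Prime →
    NumberField.IsTotallyComplex P.F → P.IsSemistable → P.AdmitsLCyclic l →
    (∀ v : HeightOneSpectrum (𝓞 P.F), P.W.HasMultiplicativeReductionAt v → ¬ ((l : ℤ) ∣ P.localHeight v)) →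
      (12 * (1 + ε))⁻¹ * l * P.degInf ≤ P.htFalt + 2 * Real.log l + C

/-! ## Lemma 3.6 — an elementary estimate (proved) -/

/-- **[GenEll] Lemma 3.6 (An Elementary Estimate)**: for every `ε > 0` there is `C₀ > 0` such that for
all real `x, y` with `y ≥ 1` and `x ≥ C₀ y^{1+ε}`, `x ≥ y · log(x)`. PROVED ("follows immediately from
the well-known elementary fact that `x^{1/(1+ε)} · log(x)/x → 0`"; here via `log x ≤ x^t/t`,
`t = ε/(1+ε)`, with `C₀ = (1/t)^{1/(1−t)}`). [cite: MochizukiGenEll2010, Lem 3.6 p.17] -/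
theorem GenEll_lemma36 (ε : ℝ) (hε : 0 < ε) :
    ∃ C₀ : ℝ, 0 < C₀ ∧ ∀ x y : ℝ, 1 ≤ y → C₀ * y ^ (1 + ε) ≤ x → y * Real.log x ≤ x := by
  set t : ℝ := ε / (1 + ε) with ht
  have h1ε : 0 < 1 + ε := by linarith
  have ht0 : 0 < t := div_pos hε h1ε
  have ht1 : t < 1 := (div_lt_one h1ε).mpr (by linarith)
  have h1t : 0 < 1 - t := by linarith
  have h1t' : 1 - t = 1 / (1 + ε) := by rw [ht]; field_simp; ring
  -- `C₀ := (1/t)^{1/(1-t)} ≥ 1`, with `C₀^{1-t} = 1/t`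
  set C₀ : ℝ := (1 / t) ^ (1 / (1 - t)) with hC₀
  have hinvt : 1 ≤ 1 / t := by rw [le_div_iff₀ ht0]; linarith
  have hC₀1 : 1 ≤ C₀ := Real.one_le_rpow hinvt (by positivity)
  have hC₀0 : 0 < C₀ := by linarith
  have hC₀pow : C₀ ^ (1 - t) = 1 / t := by
    rw [hC₀, ← Real.rpow_mul (by positivity), one_div_mul_cancel h1t.ne', Real.rpow_one]
  refine ⟨C₀, hC₀0, fun x y hy hx => ?_⟩
  have hy0 : 0 < y := by linarith
  have hypow : 1 ≤ y ^ (1 + ε) := Real.one_le_rpow hy h1ε.le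
  have hx1 : 1 ≤ x := by nlinarith
  have hx0 : 0 < x := by linarith
  -- `y ≤ (x / C₀)^{1-t}`
  have hyle : y ≤ (x / C₀) ^ (1 - t) := by
    have h1 : y ^ (1 + ε) ≤ x / C₀ := by rw [le_div_iff₀ hC₀0]; linarith
    have h2 : (y ^ (1 + ε)) ^ (1 - t) ≤ (x / C₀) ^ (1 - t) :=
      Real.rpow_le_rpow (by positivity) h1 h1t.le
    rw [← Real.rpow_mul hy0.le, h1t', mul_one_div_cancel h1ε.ne', Real.rpow_one] at h2
    rw [h1t']; exact h2
  -- `(x/C₀)^{1-t} = t · x^{1-t}` and `log x ≤ x^t / t`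
  have hsplit : (x / C₀) ^ (1 - t) = t * x ^ (1 - t) := by
    rw [Real.div_rpow hx0.le hC₀0.le, hC₀pow]; field_simp
  have hlog : Real.log x ≤ x ^ t / t := Real.log_le_rpow_div hx0.le ht0
  have hlog0 : 0 ≤ Real.log x := Real.log_nonneg hx1
  calc y * Real.log x ≤ (t * x ^ (1 - t)) * (x ^ t / t) := by
        rw [← hsplit]
        exact mul_le_mul hyle hlog hlog0 (by positivity)
    _ = x ^ (1 - t) * x ^ t := by field_simp
    _ = x := by rw [← Real.rpow_add hx0, sub_add_cancel, Real.rpow_one]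

end Literature.NumberTheory.DiophantineGeometry.GenEll

end
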